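import Literature.Geometry.Kaehler.ComplexTorusLefschetzOneOneCycles
import Literature.Geometry.Kaehler.ComplexTorusAnalyticCycleClassUnion
import Literature.Geometry.Kaehler.ComplexTorusLift
import HarnessLib

/-!
# The multiplicity-one criterion for theta functions: `div ϑ = Y` is reduced iff `c₁(L) = [Y]`

Layer `Literature/Geometry/Kaehler`, namespace `Literature.Geometry.Kaehler.ComplexTorus`; lane
`lit-hodgefound` (Track 2 foundations library), skeleton seat `lit-hodgefound-skel-2` (generation 33),
plan row A2-119 — the general form of the argument of A2-117 (`SiegelTorusThetaDivisorReduced`: the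
theta divisor of a p.p.a.v. is reduced), on top of A2-113 (`ComplexTorusPoincareLelong`: minimal theta
functions, `[Y]_e = c₁(𝒪_X(Y))`), A2-114 (`ComplexTorusLefschetzOneOneCycles`: quotient theta functions)
and p07's `ComplexTorusAnalyticCycleClassUnion` (`[Z₁ ∪ Z₂] = [Z₁] + [Z₂]` without common component).

Sources followed. H. Lange, *Abelian Varieties over the Complex Numbers* (2023), §2.1.3 p. 79 ("there
is a theta function `ϑ ∈ H⁰(L)`, uniquely determined up to a constant, such that `π^*D = (ϑ)`");
C. Voisin, *Hodge Theory and Complex Algebraic Geometry I* (2002), §11.3.1 Thm. 11.33 (Lelong: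
`[div σ] = c₁(L)`, the divisor counted WITH multiplicities `D = Σ nᵢDᵢ`); E. M. Chirka, *Complex
Analytic Sets* (1989), §2.9 Def./Prop. 1 ("minimal defining functions differ by an invertible
factor") and §2.8 Cor. 2.

THE CRITERION. For a theta function `ϑ ≢ 0` of type `(H, χ)` whose zero SET is `π⁻¹Y` (`Y` a hypersurface
of `X`), the divisor `div ϑ = Σ nᵢ Yᵢ` (`Yᵢ` the components of `Y`) is reduced — i.e. `ϑ` is a MINIMAL
defining function of `π⁻¹Y` — if and only if `c₁(L(H, χ)) = ofRealForm (-Im H)` equals the fundamental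
class `[Y]_e`: "if" because then `ϑ/ϑ_Y` is a theta function of type `(0, ψ)`, whose modulus is
`Λ`-periodic, hence a non-zero constant (Liouville); "only if" is A2-113. No irreducible components are
needed to state or prove it.

## Contents (theorems only; no definition, no named fact, net debt `0`)

* §1 `norm_apply_add_latticeVec_of_thetaFunction_zero` (a theta function of type `(0, ψ)` has `Λ`-periodic
  modulus), `exists_eq_const_of_thetaFunction_zero` (it is constant),
  **`exists_const_mul_eq_of_thetaFunction_of_analyticCycleClass_eq`** (`ϑ = c · ϑ_Y`, `c ≠ 0`),
  **`isMinimalDefiningOn_of_thetaFunction_of_analyticCycleClass_eq`** and the criterion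
  **`isMinimalDefiningOn_iff_analyticCycleClass_eq`**.
* §2 **`isMinimalDefiningOn_mul_of_union`** — for hypersurfaces `Y₁, Y₂` without a common irreducible
  component and theta functions `ϑᵢ` minimal for `π⁻¹Yᵢ`, the product `ϑ₁ϑ₂` is a minimal defining
  function of `π⁻¹(Y₁ ∪ Y₂)` (additivity of classes `analyticCycleClass_union` + §1).

## References

* [Lange2023AbelianVarietiesComplex] H. Lange, *Abelian Varieties over the Complex Numbers* (2023),
  §2.1.3 (p. 79), §1.5.4.
* [VoisinHodgeI2002] C. Voisin, *Hodge Theory and Complex Algebraic Geometry I* (2002), §11.3.1 Thm. 11.33.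
* [Chirka1989] E. M. Chirka, *Complex Analytic Sets* (1989), §2.8 Cor. 2, §2.9 Def., Prop. 1 (p. 27).
-/

noncomputable section

open scoped Manifold Topology ComplexOrder
open Set Filter Function Module TopologicalSpace Complex Bornology

namespace Literature.Geometry.Kaehler

namespace ComplexTorus

universe u

/-! ### §1 The criterion -/

section Criterion

variable {ι : Type*} [Fintype ι] [DecidableEq ι] {E : Type u} [NormedAddCommGroup E]
  [InnerProductSpace ℂ E] [FiniteDimensional ℂ E] [MeasurableSpace E] [BorelSpace E]
  (Φ : (ι → ℝ) ≃L[ℝ] E) {n d : ℕ} (e : Fin n ≃ ι) (h : 2 * d + 2 = n)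

omit [Fintype ι] [DecidableEq ι] [FiniteDimensional ℂ E] [MeasurableSpace E] [BorelSpace E] in
/-- **A theta function of type `(0, ψ)` (`|ψ| = 1`) has `Λ`-periodic modulus**: `|q(w + λ)| = |q(w)|`
(`a_{(0,ψ)}(λ, w) = ψ(λ)`). [cite: Lange2023AbelianVarietiesComplex, §1.3.1 (1.11)] -/
theorem norm_apply_add_latticeVec_of_thetaFunction_zero {ψ : (ι → ℤ) → ℂ} (hψ : ∀ m, ‖ψ m‖ = 1)
    {q : E → ℂ} (hq : q ∈ thetaFunctions Φ (canonicalFactor Φ (0 : E [⋀^Fin 2]→L[ℝ] ℝ) ψ))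
    (m : ι → ℤ) (w : E) : ‖q (w + latticeVec Φ m)‖ = ‖q w‖ := by
  obtain ⟨-, hqe⟩ := mem_thetaFunctions_iff.1 hq
  rw [hqe m w, norm_mul, canonicalFactor_apply, hermOf_zero, hermOf_zero]
  simp only [mul_zero, add_zero, Complex.exp_zero, mul_one]
  rw [hψ, one_mul]

omit [Fintype ι] [DecidableEq ι] [FiniteDimensional ℂ E] [MeasurableSpace E] [BorelSpace E] in
/-- **A theta function of type `(0, ψ)` is constant** (bounded entire: Liouville).
[cite: Lange2023AbelianVarietiesComplex, §2.1.3 (p. 79: "uniquely determined up to a constant")] -/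
theorem exists_eq_const_of_thetaFunction_zero {ψ : (ι → ℤ) → ℂ} (hψ : ∀ m, ‖ψ m‖ = 1)
    {q : E → ℂ} (hq : q ∈ thetaFunctions Φ (canonicalFactor Φ (0 : E [⋀^Fin 2]→L[ℝ] ℝ) ψ)) :
    ∀ w, q w = q 0 := by
  have hqd : Differentiable ℂ q := (mem_thetaFunctions_iff.1 hq).1
  have hbdd : IsBounded (range q) := by
    have h := isBounded_range_of_latticePeriodic (Φ := Φ) (D := fun w ↦ ‖q w‖)
      (continuous_norm.comp hqd.continuous) (norm_apply_add_latticeVec_of_thetaFunction_zero Φ hψ hq)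
    obtain ⟨C, hC⟩ := h.subset_closedBall 0
    refine isBounded_iff_forall_norm_le.2 ⟨C, ?_⟩
    rintro _ ⟨w, rfl⟩
    have := hC ⟨w, rfl⟩
    rwa [Metric.mem_closedBall, dist_zero_right, Real.norm_eq_abs, abs_norm] at this
  exact fun w ↦ hqd.apply_eq_apply_of_bounded hbdd w 0

include h in
/-- **`ϑ = c · ϑ_Y` when `c₁(L(H, χ)) = [Y]_e`.** Let `Y ⊂ X` be a hypersurface (`e` positively oriented),
`ϑ` a theta function of type `(H, χ)` with zero set `π⁻¹Y`, and assume `[Y]_e = ofRealForm (-Im H)`.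
Then for the minimal theta function `ϑ_Y` of A2-113 (type `(H, χ_Y)` — same `H` by uniqueness) there is
`c ≠ 0` with `ϑ = c · ϑ_Y`: the quotient is a theta function of type `(0, χχ_Y⁻¹)`, hence constant.
[cite: Lange2023AbelianVarietiesComplex, §2.1.3 (p. 79)] [cite: VoisinHodgeI2002, §11.3.1 Thm. 11.33] -/
theorem exists_const_mul_eq_of_thetaFunction_of_analyticCycleClass_eq {Y : Set (ComplexTorus Φ)}
    (hY : HasPureDim 𝓘(ℂ, E) Y d) (he : orientationSign Φ e = 1)
    {η : E [⋀^Fin 2]→L[ℝ] ℝ} {χ : (ι → ℤ) → ℂ} (hχ : IsSemicharacter Φ η χ)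
    {ϑ : E → ℂ} (hϑ : ϑ ∈ thetaFunctions Φ (canonicalFactor Φ η χ))
    (hzero : {w | ϑ w = 0} = cover Φ ⁻¹' Y) (hcl : analyticCycleClass Φ e h hY = ofRealForm (-η)) :
    ∃ (χY : (ι → ℤ) → ℂ) (ϑY : E → ℂ) (c : ℂ), IsSemicharacter Φ η χY ∧
      ϑY ∈ thetaFunctions Φ (canonicalFactor Φ η χY) ∧
      SCV.IsMinimalDefiningOn (cover Φ ⁻¹' Y) univ ϑY ∧ c ≠ 0 ∧ ∀ w, ϑ w = c * ϑY w := by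
  have hdim : finrank ℂ E = d + 1 := finrank_eq_succ_of_rank Φ e h
  obtain ⟨-, ηY, χY, hηY, hχY, ϑY, -, -, hϑY, hϑY0, hzeroY, hmin, hclY⟩ :=
    analyticCycleClass_eq_chernClass_of_hasPureDim Φ e h hY he
  have hηη : ηY = η := neg_injective (ofRealForm_injective (hclY.symm.trans hcl))
  subst hηη
  have hϑd : Differentiable ℂ ϑ := (mem_thetaFunctions_iff.1 hϑ).1
  -- division by the minimal theta function
  obtain ⟨q, hqd, hq⟩ := hmin.dvd univ ϑ isOpen_univ subset_rfl hϑd.differentiableOn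
    (fun y hy ↦ by
      have : y ∈ {w | ϑ w = 0} := by rw [hzero]; exact hy.2
      exact this)
  have hqd' : Differentiable ℂ q := differentiableOn_univ.1 hqd
  have hq' : ∀ w, ϑ w = q w * ϑY w := fun w ↦ hq w (mem_univ w)
  -- `{ϑ_Y ≠ 0}` is dense
  have hYc : HasPureCodim 𝓘(ℂ, E) Y 1 := by
    have := hY.hasPureCodim
    rwa [hdim, show d + 1 - d = 1 by omega] at this
  have hdense : Dense {v | ϑY v ≠ 0} := by
    have hint : interior {v | ϑY v = 0} = ∅ := by
      rw [hzeroY]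
      exact SCV.interior_eq_empty_of_hasPureCodim (hasPureCodim_cover_preimage (Φ := Φ) hYc)
    have := interior_eq_empty_iff_dense_compl.1 hint
    convert this using 1
    ext v
    simp
  -- the quotient is a theta function of type `(0, χ χ_Y⁻¹)`, hence a constant
  have hqθ := mem_thetaFunctions_of_eq_mul Φ hχY hϑ hϑY hqd' hq' hdense
  rw [sub_self] at hqθ
  have hψ : ∀ m, ‖(χ * χY⁻¹) m‖ = 1 := fun m ↦ by
    rw [Pi.mul_apply, Pi.inv_apply, norm_mul, norm_inv, hχ.norm_eq_one, hχY.norm_eq_one, inv_one,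
      mul_one]
  have hconst := exists_eq_const_of_thetaFunction_zero Φ hψ hqθ
  have hc0 : q 0 ≠ 0 := fun h0 ↦ by
    -- then `ϑ ≡ 0`, but `{ϑ = 0} = π⁻¹Y ≠ E`
    have hall : ∀ w, ϑ w = 0 := fun w ↦ by rw [hq' w, hconst w, h0, zero_mul]
    have hint : interior {w | ϑ w = 0} = ∅ := by
      rw [hzero]
      exact SCV.interior_eq_empty_of_hasPureCodim (hasPureCodim_cover_preimage (Φ := Φ) hYc)
    have huniv : {w | ϑ w = 0} = univ := eq_univ_of_forall hall
    rw [huniv, interior_univ] at hint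
    exact (univ_nonempty (α := E)).ne_empty hint
  exact ⟨χY, ϑY, q 0, hχY, hϑY, hmin, hc0, fun w ↦ by rw [hq' w, hconst w]⟩

/-- Minimality is invariant under multiplication by a non-zero constant.
[cite: Chirka1989, §2.9 (p. 27: minimal defining functions differ by an invertible factor)] -/
theorem _root_.Literature.Geometry.Kaehler.SCV.IsMinimalDefiningOn.const_mul
    {E : Type*} [NormedAddCommGroup E] [NormedSpace ℂ E] {A Ω : Set E} {f : E → ℂ}
    (hf : SCV.IsMinimalDefiningOn A Ω f) {c : ℂ} (hc : c ≠ 0) :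
    SCV.IsMinimalDefiningOn A Ω (fun x ↦ c * f x) where
  isOpen := hf.isOpen
  differentiableOn := hf.differentiableOn.const_mul c
  eq_zero_iff y hy := by rw [mul_eq_zero, or_iff_right hc, hf.eq_zero_iff y hy]
  dvd U g hU hUΩ hg hgA := by
    obtain ⟨k, hk, hgk⟩ := hf.dvd U g hU hUΩ hg hgA
    refine ⟨fun x ↦ k x * c⁻¹, hk.mul_const c⁻¹, fun y hy ↦ ?_⟩
    rw [hgk y hy]
    field_simp

include h in
/-- **Class equality forces multiplicity one**: under the hypotheses of
`exists_const_mul_eq_of_thetaFunction_of_analyticCycleClass_eq`, `ϑ` itself is a minimal defining function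
of `π⁻¹Y` — the divisor of `ϑ` is `Y`, reduced. [cite: VoisinHodgeI2002, §11.3.1 Thm. 11.33]
[cite: Chirka1989, §2.9 Def. (p. 27)] -/
theorem isMinimalDefiningOn_of_thetaFunction_of_analyticCycleClass_eq {Y : Set (ComplexTorus Φ)}
    (hY : HasPureDim 𝓘(ℂ, E) Y d) (he : orientationSign Φ e = 1)
    {η : E [⋀^Fin 2]→L[ℝ] ℝ} {χ : (ι → ℤ) → ℂ} (hχ : IsSemicharacter Φ η χ)
    {ϑ : E → ℂ} (hϑ : ϑ ∈ thetaFunctions Φ (canonicalFactor Φ η χ))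
    (hzero : {w | ϑ w = 0} = cover Φ ⁻¹' Y) (hcl : analyticCycleClass Φ e h hY = ofRealForm (-η)) :
    SCV.IsMinimalDefiningOn (cover Φ ⁻¹' Y) univ ϑ := by
  obtain ⟨-, ϑY, c, -, -, hmin, hc0, hcϑ⟩ :=
    exists_const_mul_eq_of_thetaFunction_of_analyticCycleClass_eq Φ e h hY he hχ hϑ hzero hcl
  have hfun : ϑ = fun w ↦ c * ϑY w := funext hcϑ
  rw [hfun]
  exact hmin.const_mul hc0

include h in
/-- **THE MULTIPLICITY-ONE CRITERION.** Let `Y ⊂ X = E/Λ` be a closed analytic hypersurface (`e`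
positively oriented), `H ∈ NS(X)`, `χ` a semicharacter and `ϑ` a theta function of type `(H, χ)` with
zero set `{ϑ = 0} = π⁻¹Y`. Then `ϑ` is a minimal defining function of `π⁻¹Y` (i.e. `div ϑ = Y` with
multiplicity one along every branch) **if and only if** `[Y]_e = ofRealForm (-Im H) = c₁(L(H, χ))`
("only if": A2-113 `analyticCycleClass_eq_ofRealForm_neg_of_thetaFunction`; "if": above). Lelong's
`[div σ] = c₁(L)` with `div σ = Σ nᵢ Yᵢ` says the same: all `nᵢ = 1` iff `c₁(L) = [Y_red]`.
[cite: VoisinHodgeI2002, §11.3.1 Thm. 11.33] [cite: Lange2023AbelianVarietiesComplex, §2.1.3 (p. 79)] -/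
theorem isMinimalDefiningOn_iff_analyticCycleClass_eq {Y : Set (ComplexTorus Φ)}
    (hY : HasPureDim 𝓘(ℂ, E) Y d) (he : orientationSign Φ e = 1)
    {η : E [⋀^Fin 2]→L[ℝ] ℝ} {χ : (ι → ℤ) → ℂ} (hη : IsNSForm Φ η) (hχ : IsSemicharacter Φ η χ)
    {ϑ : E → ℂ} (hϑ : ϑ ∈ thetaFunctions Φ (canonicalFactor Φ η χ))
    (hzero : {w | ϑ w = 0} = cover Φ ⁻¹' Y) :
    SCV.IsMinimalDefiningOn (cover Φ ⁻¹' Y) univ ϑ ↔ analyticCycleClass Φ e h hY = ofRealForm (-η) := by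
  refine ⟨fun hmin ↦ ?_, fun hcl ↦
    isMinimalDefiningOn_of_thetaFunction_of_analyticCycleClass_eq Φ e h hY he hχ hϑ hzero hcl⟩
  have hϑ0 : ϑ ≠ 0 := fun h0 ↦ by
    have hdim : finrank ℂ E = d + 1 := finrank_eq_succ_of_rank Φ e h
    have hYc : HasPureCodim 𝓘(ℂ, E) Y 1 := by
      have := hY.hasPureCodim
      rwa [hdim, show d + 1 - d = 1 by omega] at this
    have hint : interior {w | ϑ w = 0} = ∅ := by
      rw [hzero]
      exact SCV.interior_eq_empty_of_hasPureCodim (hasPureCodim_cover_preimage (Φ := Φ) hYc)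
    have huniv : {w | ϑ w = 0} = univ := eq_univ_of_forall fun w ↦ by rw [h0]; rfl
    rw [huniv, interior_univ] at hint
    exact (univ_nonempty (α := E)).ne_empty hint
  exact analyticCycleClass_eq_ofRealForm_neg_of_thetaFunction Φ e h hY he hη hχ hϑ hϑ0 hzero hmin

end Criterion

/-! ### §2 Products of minimal theta functions of hypersurfaces without common component -/

section Union

variable {ι : Type*} [Fintype ι] [DecidableEq ι] {E : Type u} [NormedAddCommGroup E]
  [InnerProductSpace ℂ E] [FiniteDimensional ℂ E] [MeasurableSpace E] [BorelSpace E]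
  (Φ : (ι → ℝ) ≃L[ℝ] E) {n d : ℕ} (e : Fin n ≃ ι) (h : 2 * d + 2 = n)

include e h in
/-- **The product of the minimal theta functions of two hypersurfaces without common irreducible
component is the minimal theta function of their union**: if `ϑᵢ` (type `(Hᵢ, χᵢ)`) is a minimal
defining function of `π⁻¹Yᵢ` (`i = 1, 2`) and `Y₁`, `Y₂` share no irreducible component, then `ϑ₁ϑ₂`
(type `(H₁ + H₂, χ₁χ₂)`) is a minimal defining function of `π⁻¹(Y₁ ∪ Y₂)` — by the criterion, since
`[Y₁ ∪ Y₂] = [Y₁] + [Y₂] = c₁(L(H₁,χ₁)) + c₁(L(H₂,χ₂))` (`analyticCycleClass_union`). (With a common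
component the product vanishes to order two along it and is not minimal.)
[cite: Chirka1989, §2.8 Cor. 2 and §2.9 Prop. 1 (p. 27)] [cite: Lange2023AbelianVarietiesComplex, §6.2.1 and §2.1.3 (p. 79)] -/
theorem isMinimalDefiningOn_mul_of_union {Y₁ Y₂ : Set (ComplexTorus Φ)}
    (hY₁ : HasPureDim 𝓘(ℂ, E) Y₁ d) (hY₂ : HasPureDim 𝓘(ℂ, E) Y₂ d)
    (hdisj : ∀ C, IsIrreducibleComponent 𝓘(ℂ, E) Y₁ C → ¬ IsIrreducibleComponent 𝓘(ℂ, E) Y₂ C)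
    {η₁ η₂ : E [⋀^Fin 2]→L[ℝ] ℝ} {χ₁ χ₂ : (ι → ℤ) → ℂ} (hη₁ : IsNSForm Φ η₁) (hη₂ : IsNSForm Φ η₂)
    (hχ₁ : IsSemicharacter Φ η₁ χ₁) (hχ₂ : IsSemicharacter Φ η₂ χ₂) {ϑ₁ ϑ₂ : E → ℂ}
    (hϑ₁ : ϑ₁ ∈ thetaFunctions Φ (canonicalFactor Φ η₁ χ₁))
    (hϑ₂ : ϑ₂ ∈ thetaFunctions Φ (canonicalFactor Φ η₂ χ₂))
    (hmin₁ : SCV.IsMinimalDefiningOn (cover Φ ⁻¹' Y₁) univ ϑ₁)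
    (hmin₂ : SCV.IsMinimalDefiningOn (cover Φ ⁻¹' Y₂) univ ϑ₂) :
    SCV.IsMinimalDefiningOn (cover Φ ⁻¹' (Y₁ ∪ Y₂)) univ fun w ↦ ϑ₁ w * ϑ₂ w := by
  obtain ⟨e₀, he₀⟩ := exists_orientationSign_eq_one Φ e
  have hzero₁ : {w | ϑ₁ w = 0} = cover Φ ⁻¹' Y₁ :=
    Set.ext fun w ↦ by simpa using hmin₁.eq_zero_iff w (mem_univ w)
  have hzero₂ : {w | ϑ₂ w = 0} = cover Φ ⁻¹' Y₂ :=
    Set.ext fun w ↦ by simpa using hmin₂.eq_zero_iff w (mem_univ w)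
  -- the classes of `Y₁`, `Y₂` from the "only if" half of the criterion
  have hcl₁ := (isMinimalDefiningOn_iff_analyticCycleClass_eq Φ e₀ h hY₁ he₀ hη₁ hχ₁ hϑ₁ hzero₁).1 hmin₁
  have hcl₂ := (isMinimalDefiningOn_iff_analyticCycleClass_eq Φ e₀ h hY₂ he₀ hη₂ hχ₂ hϑ₂ hzero₂).1 hmin₂
  -- the product: type `(η₁ + η₂, χ₁χ₂)`, zero set `π⁻¹(Y₁ ∪ Y₂)`, class `[Y₁] + [Y₂]`
  have hprod : (fun w ↦ ϑ₁ w * ϑ₂ w) ∈ thetaFunctions Φ (canonicalFactor Φ (η₁ + η₂) (χ₁ * χ₂)) := by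
    obtain ⟨h1d, h1e⟩ := mem_thetaFunctions_iff.1 hϑ₁
    obtain ⟨h2d, h2e⟩ := mem_thetaFunctions_iff.1 hϑ₂
    rw [canonicalFactor_add_mul]
    refine mem_thetaFunctions_iff.2 ⟨h1d.mul h2d, fun m v ↦ ?_⟩
    simp only [Pi.mul_apply, h1e m v, h2e m v]
    ring
  have hzero : {w | ϑ₁ w * ϑ₂ w = 0} = cover Φ ⁻¹' (Y₁ ∪ Y₂) := by
    ext w
    simp only [mem_setOf_eq, mul_eq_zero, preimage_union, mem_union]
    rw [show (ϑ₁ w = 0) = (w ∈ {w | ϑ₁ w = 0}) from rfl, show (ϑ₂ w = 0) = (w ∈ {w | ϑ₂ w = 0}) from rfl,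
      hzero₁, hzero₂, mem_preimage, mem_preimage]
  have hcl : analyticCycleClass Φ e₀ h (hY₁.union hY₂) = ofRealForm (-(η₁ + η₂)) := by
    rw [analyticCycleClass_union Φ e₀ h hY₁ hY₂ hdisj, hcl₁, hcl₂, neg_add, ofRealForm_add]
  exact isMinimalDefiningOn_of_thetaFunction_of_analyticCycleClass_eq Φ e₀ h (hY₁.union hY₂) he₀
    (hχ₁.mul hχ₂) hprod hzero hcl

end Union

end ComplexTorus

end Literature.Geometry.Kaehler

end
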